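import Literature.NumberTheory.LFunctions.WeilFirstPrimeCertificateDataC
import HarnessLib

/-!
# First-prime Weil positivity, stage C: kernel check of the even scaled moments ν_60, ν_62, ν_64, ν_66, ν_68, ν_70

Part of `weilCert3C.check` (`WeilFirstPrimeCertificateDataC.lean`), evaluated by `decide +kernel` and kept in its own
file for kernel time and memory (each declaration is checked separately). Assembled in
`WeilFirstPrimeCertificateCCheck.lean`. Pure proof file; nothing is asserted.
-/

noncomputable section

namespace Literature.NumberTheory.LFunctions

set_option maxHeartbeats 0 in
/-- **Kernel check of the scaled moment `ν_{60}`** of the stage-C first-prime certificate. [folklore] -/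
theorem checkNuAt60_weilCert3C : weilCert3C.checkNuAt 60 = true := by
  decide +kernel

set_option maxHeartbeats 0 in
/-- **Kernel check of the scaled moment `ν_{62}`** of the stage-C first-prime certificate. [folklore] -/
theorem checkNuAt62_weilCert3C : weilCert3C.checkNuAt 62 = true := by
  decide +kernel

set_option maxHeartbeats 0 in
/-- **Kernel check of the scaled moment `ν_{64}`** of the stage-C first-prime certificate. [folklore] -/
theorem checkNuAt64_weilCert3C : weilCert3C.checkNuAt 64 = true := by
  decide +kernel

set_option maxHeartbeats 0 in
/-- **Kernel check of the scaled moment `ν_{66}`** of the stage-C first-prime certificate. [folklore] -/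
theorem checkNuAt66_weilCert3C : weilCert3C.checkNuAt 66 = true := by
  decide +kernel

set_option maxHeartbeats 0 in
/-- **Kernel check of the scaled moment `ν_{68}`** of the stage-C first-prime certificate. [folklore] -/
theorem checkNuAt68_weilCert3C : weilCert3C.checkNuAt 68 = true := by
  decide +kernel

set_option maxHeartbeats 0 in
/-- **Kernel check of the scaled moment `ν_{70}`** of the stage-C first-prime certificate. [folklore] -/
theorem checkNuAt70_weilCert3C : weilCert3C.checkNuAt 70 = true := by
  decide +kernel

end Literature.NumberTheory.LFunctions
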